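import Mathlib

/-!
# Cyclotomic real lift — the elements `∑ c_j (ζ^j + ζ^{-j})` of `ℤ[ζ_{2d+1}]` and their two
reductions modulo a split prime
(crux `LevelOneGL2Designs`, stmt-MatrixMultiplication-14080, wall stub `stub_tangencySets`;
wall-breaker axis k8/12 "parabola lifts over finite fields", generation 1)

Pohoata (arXiv:2607.20422, Thm. 1.3 / Prop. 5.1) builds induced point–line matchings of size
`≳_r q^{3/2 − 2/(r−1)}` in `𝔽_q²` for primes `q ≡ ±1 (mod r)` by lifting a parabola along the
trace-zero slice of the ring of integers of the maximal real subfield of `ℚ(ζ_r)`.  This file sets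
up the algebra of that construction for EVERY prime `r = 2d + 1` inside Mathlib's
`CyclotomicField (d+d+1) ℚ`, never mentioning the real subfield:

* the real integers `x c = ∑_{i<2d} c(fold i) ζ^{i+1} = ∑_{j<d} c_j (ζ^{j+1} + ζ^{-(j+1)})`
  attached to coefficient vectors `c : Fin d → ℤ` (`x`, `coe_x`, `algHom_x`);
* injectivity of `c ↦ x c` (`x_injective`, from the linear independence of `ζ, …, ζ^{2d}`);
* realness: every complex conjugate of `x c` is real (`conj_embedding_x`), with the conjugate
  bound `|σ(x c)| ≤ 2d · max |c_j|` (`norm_embedding_x_le`);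
* traces: all `ζ^k` (`1 ≤ k ≤ 2d`) are Galois conjugate, so `Tr(x c) = Tr(ζ) · ∑_i c(fold i)`
  (`trace_x`), and the vectors `ext b` (last coordinate corrected so that the coordinates sum to
  zero) give TRACE-ZERO elements (`trace_x_ext`);
* the reduction `red g : 𝓞 K → ZMod p`, `ζ ↦ g`, for a primitive `(2d+1)`-st root of unity `g` of
  `ZMod p` (`p ≡ 1 (mod 2d+1)`), the identity `red g⁻¹ (x c) = red g (x c)` (`red_inv_x`: the two
  reductions agree on real elements) and `ker (red g) ≠ ker (red g⁻¹)` (`ker_red_ne`).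

The companion files `…RealLiftNoWrap` (no wrap-around via the two kernels, trace positivity) and
`…CyclotomicLiftSRS` (the strong representative systems) complete the formalisation.

References: C. Pohoata, *The sharp exponent for the minimal distance problem*, arXiv:2607.20422
(2026), §§3–5 [bib: Pohoata2026SharpExponentMinimalDistance]; Z. Hunter, C. Pohoata,
J. Verstraëte, S. Zhang, arXiv:2601.19879 (2026) [bib: HunterPohoataVerstraeteZhang2026].
-/

-- justification: the summit/problem path `MatrixMultiplication.MatrixMultiplication` is fixed by the
-- tree layout (D-0017), so the namespace necessarily repeats a component.
set_option linter.dupNamespace false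
-- justification: `CyclotomicField` is a plain `def`; Mathlib itself elaborates its instances under
-- this option (see `Mathlib/NumberTheory/NumberField/Cyclotomic/Basic.lean`).

set_option backward.isDefEq.respectTransparency false

noncomputable section

open NumberField IsCyclotomicExtension Polynomial Finset

namespace Summit.MatrixMultiplication.MatrixMultiplication.Theorems.LevelOneGL2Designs.CyclotomicLift

variable (d : ℕ)

/-! ### Folding exponents -/

/-- Fold the exponent index `i ∈ [0, 2d)` (standing for the exponent `i + 1 ∈ [1, 2d]` of `ζ`) to
`[0, d)`: the exponents `j + 1` and `(2d + 1) - (j + 1)` both fold to `j`. -/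
def fold (i : Fin (d + d)) : Fin d :=
  if h : (i : ℕ) < d then ⟨i, h⟩ else ⟨d + d - 1 - i, by omega⟩

/-- `fold` is invariant under `i ↦ 2d - 1 - i` (exponent `e ↦ (2d+1) - e`). -/
theorem fold_rev (i : Fin (d + d)) : fold d i.rev = fold d i := by
  unfold fold
  ext
  simp only [Fin.val_rev]
  split_ifs with h1 h2 h2 <;> simp <;> omega

/-- `fold` on the first half is the identity. -/
theorem fold_castAdd (j : Fin d) : fold d (Fin.castAdd d j) = j := by
  unfold fold
  ext
  simp [j.2]

/-- `fold` on the second half is the reversal. -/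
theorem fold_natAdd (j : Fin d) : fold d (Fin.natAdd d j) = j.rev := by
  unfold fold
  ext
  simp only [Fin.val_natAdd, Fin.val_rev]
  split_ifs with h
  · omega
  · simp; omega

/-- Summing a function of the folded index counts every value twice. -/
theorem sum_fold {M : Type*} [AddCommMonoid M] (f : Fin d → M) :
    ∑ i : Fin (d + d), f (fold d i) = ∑ j : Fin d, f j + ∑ j : Fin d, f j := by
  rw [Fin.sum_univ_add]
  congr 1
  · exact Finset.sum_congr rfl fun j _ => by rw [fold_castAdd]
  · rw [← Equiv.sum_comp Fin.revPerm]
    exact Finset.sum_congr rfl fun j _ => by rw [Fin.revPerm_apply, fold_natAdd, Fin.rev_rev]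

/-- **Symmetry of folded sums.**  For `u` with `u^{2d+1} = 1` in a field,
`∑_i c(fold i) u^{-(i+1)} = ∑_i c(fold i) u^{i+1}`: inversion permutes the exponents `1, …, 2d`
by `e ↦ (2d+1) - e`, which preserves the fold. -/
theorem sum_fold_inv {F : Type*} [Field F] (u : F) (hu : u ^ (d + d + 1) = 1) (a : Fin d → F) :
    ∑ i : Fin (d + d), a (fold d i) * u⁻¹ ^ ((i : ℕ) + 1) =
      ∑ i : Fin (d + d), a (fold d i) * u ^ ((i : ℕ) + 1) := by
  have hu0 : u ≠ 0 := by
    rintro rfl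
    simp at hu
  have key : ∀ i : Fin (d + d), u⁻¹ ^ ((i : ℕ) + 1) = u ^ ((i.rev : ℕ) + 1) := by
    intro i
    rw [inv_pow]
    refine inv_eq_of_mul_eq_one_right ?_
    rw [← pow_add, Fin.val_rev]
    convert hu using 2
    omega
  simp_rw [key]
  rw [← Equiv.sum_comp Fin.revPerm]
  refine Finset.sum_congr rfl fun i _ => ?_
  simp [fold_rev]

/-! ### The cyclotomic field and the lifted elements -/

/-- The cyclotomic field `ℚ(ζ_{2d+1})`. -/
abbrev K : Type := CyclotomicField (d + d + 1) ℚ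

/-- `2d + 1 ≠ 0`. -/
instance : NeZero (d + d + 1) := ⟨by omega⟩

/-- The chosen primitive `(2d+1)`-st root of unity. -/
def ζ : K d := zeta (d + d + 1) ℚ (K d)

/-- `ζ` is a primitive `(2d+1)`-st root of unity. -/
theorem isPrimitiveRoot_ζ : IsPrimitiveRoot (ζ d) (d + d + 1) := zeta_spec (d + d + 1) ℚ (K d)

/-- `ζ` as an algebraic integer. -/
def ζi : 𝓞 (K d) := (isPrimitiveRoot_ζ d).toInteger

/-- `ζi` is `ζ`. -/
@[simp] theorem algebraMap_ζi : algebraMap (𝓞 (K d)) (K d) (ζi d) = ζ d := rfl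

/-- `ζ^{2d+1} = 1`. -/
theorem ζ_pow_r : ζ d ^ (d + d + 1) = 1 := (isPrimitiveRoot_ζ d).pow_eq_one

/-- `ζ ≠ 0`. -/
theorem ζ_ne_zero : ζ d ≠ 0 := (isPrimitiveRoot_ζ d).ne_zero (by omega)

/-- The real algebraic integer attached to a coefficient vector `c : Fin d → ℤ`:
`x c = ∑_{j<d} c_j (ζ^{j+1} + ζ^{-(j+1)})`, written as a sum over the exponents `1, …, 2d`. -/
def x (c : Fin d → ℤ) : 𝓞 (K d) :=
  ∑ i : Fin (d + d), (c (fold d i) : 𝓞 (K d)) * ζi d ^ ((i : ℕ) + 1)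

/-- `x` is additive: `x c - x c' = x (c - c')`. -/
theorem x_sub (c c' : Fin d → ℤ) : x d c - x d c' = x d (c - c') := by
  unfold x
  rw [← Finset.sum_sub_distrib]
  refine Finset.sum_congr rfl fun i _ => ?_
  simp only [Pi.sub_apply, Int.cast_sub]
  ring

/-- `x c` as an element of the field: the folded `ℚ`-linear combination of `ζ, …, ζ^{2d}`. -/
theorem coe_x (c : Fin d → ℤ) :
    algebraMap (𝓞 (K d)) (K d) (x d c) =
      ∑ i : Fin (d + d), (c (fold d i) : ℚ) • ζ d ^ ((i : ℕ) + 1) := by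
  simp only [x, map_sum, map_mul, map_pow, map_intCast]
  refine Finset.sum_congr rfl fun i _ => ?_
  rw [show algebraMap (𝓞 (K d)) (K d) (ζi d) = ζ d from rfl, Algebra.smul_def, map_intCast]

/-- Image of `x c` under a `ℚ`-algebra map `σ` (an embedding into `ℂ`, say): the same sum in
`u = σ(ζ)`. -/
theorem algHom_x {F : Type*} [Field F] [Algebra ℚ F] (σ : K d →ₐ[ℚ] F) (c : Fin d → ℤ) :
    σ (algebraMap (𝓞 (K d)) (K d) (x d c)) =
      ∑ i : Fin (d + d), (c (fold d i) : F) * σ (ζ d) ^ ((i : ℕ) + 1) := by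
  rw [coe_x, map_sum]
  refine Finset.sum_congr rfl fun i _ => ?_
  rw [map_smul, map_pow, Algebra.smul_def, map_intCast]

/-- **Realness.**  Every complex conjugate of `x c` is real. -/
theorem conj_embedding_x (σ : K d →ₐ[ℚ] ℂ) (c : Fin d → ℤ) :
    starRingEnd ℂ (σ (algebraMap (𝓞 (K d)) (K d) (x d c))) =
      σ (algebraMap (𝓞 (K d)) (K d) (x d c)) := by
  have hu : σ (ζ d) ^ (d + d + 1) = 1 := by rw [← map_pow, ζ_pow_r, map_one]
  have hnorm : ‖σ (ζ d)‖ = 1 := Complex.norm_eq_one_of_pow_eq_one hu (by omega)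
  rw [algHom_x, map_sum]
  simp_rw [map_mul, map_pow, map_intCast, ← Complex.inv_eq_conj hnorm]
  exact sum_fold_inv d (σ (ζ d)) hu (fun j => (c j : ℂ))

/-- **Conjugate bound.**  If `|c_j| ≤ C` for all `j` then every conjugate of `x c` has modulus
`≤ 2d·C`. -/
theorem norm_embedding_x_le (σ : K d →ₐ[ℚ] ℂ) (c : Fin d → ℤ) {C : ℝ}
    (hC : ∀ j, (|c j| : ℝ) ≤ C) :
    ‖σ (algebraMap (𝓞 (K d)) (K d) (x d c))‖ ≤ (d + d : ℕ) * C := by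
  have hu : σ (ζ d) ^ (d + d + 1) = 1 := by rw [← map_pow, ζ_pow_r, map_one]
  have hnorm : ‖σ (ζ d)‖ = 1 := Complex.norm_eq_one_of_pow_eq_one hu (by omega)
  rw [algHom_x]
  calc ‖∑ i : Fin (d + d), (c (fold d i) : ℂ) * σ (ζ d) ^ ((i : ℕ) + 1)‖
      ≤ ∑ i : Fin (d + d), ‖(c (fold d i) : ℂ) * σ (ζ d) ^ ((i : ℕ) + 1)‖ := norm_sum_le _ _
    _ ≤ ∑ _i : Fin (d + d), C := by
        refine Finset.sum_le_sum fun i _ => ?_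
        rw [norm_mul, norm_pow, hnorm, one_pow, mul_one, Complex.norm_intCast]
        exact hC _
    _ = (d + d : ℕ) * C := by simp

/-! ### The trace-zero coefficient vectors -/

/-- Subtract the sum of all coordinates of `b` from its last coordinate, so that the coordinates
of `ext b` sum to `0`; on vectors with `b (d-1) = 0` this is the usual "solve for the last
coordinate" and is injective. -/
def ext (b : Fin d → ℤ) : Fin d → ℤ := fun j => if (j : ℕ) = d - 1 then b j - ∑ j', b j' else b j

/-- The coordinates of `ext b` sum to zero. -/
theorem sum_ext (hd : 0 < d) (b : Fin d → ℤ) : ∑ j, ext d b j = 0 := by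
  unfold ext
  rw [Finset.sum_ite, Finset.sum_sub_distrib]
  have hfilter : (univ.filter fun j : Fin d => (j : ℕ) = d - 1) = {⟨d - 1, by omega⟩} := by
    ext j
    simp [Fin.ext_iff]
  rw [hfilter, Finset.sum_singleton, Finset.sum_singleton]
  have hsplit := Finset.sum_filter_add_sum_filter_not univ (fun j : Fin d => (j : ℕ) = d - 1) b
  rw [hfilter, Finset.sum_singleton] at hsplit
  linarith

/-- `ext` is additive. -/
theorem ext_sub (b b' : Fin d → ℤ) : ext d b - ext d b' = ext d (b - b') := by
  funext j
  simp only [ext, Pi.sub_apply, Finset.sum_sub_distrib]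
  split_ifs <;> ring

/-- `ext` is injective on vectors with vanishing last coordinate. -/
theorem ext_injOn : Set.InjOn (ext d) {b | ∀ j : Fin d, (j : ℕ) = d - 1 → b j = 0} := by
  intro b hb b' hb' h
  funext j
  by_cases hj : (j : ℕ) = d - 1
  · rw [hb j hj, hb' j hj]
  · have := congr_fun h j
    simpa [ext, hj] using this

/-- Box bound: `|ext b|_∞ ≤ (d+1) |b|_∞`. -/
theorem abs_ext_le (b : Fin d → ℤ) {R : ℤ} (hb : ∀ j, |b j| ≤ R) (j : Fin d) :
    |ext d b j| ≤ (d + 1 : ℕ) * R := by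
  have hR : 0 ≤ R := le_trans (abs_nonneg _) (hb j)
  unfold ext
  split_ifs
  · calc |b j - ∑ j', b j'| ≤ |b j| + |∑ j', b j'| := abs_sub _ _
      _ ≤ R + ∑ j', |b j'| := add_le_add (hb j) (Finset.abs_sum_le_sum_abs _ _)
      _ ≤ R + ∑ _j' : Fin d, R := by gcongr with j' _; exact hb j'
      _ = (d + 1 : ℕ) * R := by simp; ring
  · calc |b j| ≤ R := hb j
      _ = 1 * R := (one_mul R).symm
      _ ≤ (d + 1 : ℕ) * R := by gcongr; exact_mod_cast Nat.le_add_left 1 d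

variable [hr : Fact (Nat.Prime (d + d + 1))]

/-- `ζ, ζ², …, ζ^{2d}` are linearly independent over `ℚ` (`2d = φ(2d+1)` is the degree). -/
theorem linearIndependent_pow :
    LinearIndependent ℚ (fun i : Fin (d + d) => ζ d ^ ((i : ℕ) + 1)) := by
  let pb := (isPrimitiveRoot_ζ d).powerBasis ℚ
  have hdim : pb.dim = d + d := by
    rw [← pb.finrank, IsCyclotomicExtension.Rat.finrank (d + d + 1) (K d),
      Nat.totient_prime hr.out]
    omega
  have hgen : pb.gen = ζ d := (isPrimitiveRoot_ζ d).powerBasis_gen ℚ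
  -- independence of `ζ^0, …, ζ^{2d-1}` indexed by `Fin (2d)`
  have h0 : LinearIndependent ℚ (fun i : Fin (d + d) => ζ d ^ (i : ℕ)) := by
    have h := pb.basis.linearIndependent
    rw [pb.coe_basis, hgen] at h
    have := h.comp (finCongr hdim.symm) (finCongr hdim.symm).injective
    rwa [show ((fun i : Fin pb.dim => ζ d ^ (i : ℕ)) ∘ (finCongr hdim.symm)) =
      fun i : Fin (d + d) => ζ d ^ (i : ℕ) from funext fun i => by simp] at this
  rw [Fintype.linearIndependent_iff] at h0 ⊢
  intro g hg i
  apply h0 g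
  have : (ζ d) * ∑ i, g i • ζ d ^ (i : ℕ) = ∑ i, g i • ζ d ^ ((i : ℕ) + 1) := by
    rw [Finset.mul_sum]
    refine Finset.sum_congr rfl fun i _ => ?_
    rw [mul_smul_comm, pow_succ']
  have h2 : (ζ d) * ∑ i, g i • ζ d ^ (i : ℕ) = 0 := by rw [this, hg]
  exact (mul_eq_zero.mp h2).resolve_left (ζ_ne_zero d)

/-- The coefficient vector is determined by the element: `c ↦ x c` is injective. -/
theorem x_injective : Function.Injective (x d) := by
  intro c c' h
  have h' := congrArg (algebraMap (𝓞 (K d)) (K d)) h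
  rw [coe_x, coe_x, ← sub_eq_zero, ← Finset.sum_sub_distrib] at h'
  simp_rw [← sub_smul] at h'
  have hli := (Fintype.linearIndependent_iff.mp (linearIndependent_pow d)) _ h'
  funext j
  have := hli (Fin.castAdd d j)
  rw [fold_castAdd] at this
  exact_mod_cast sub_eq_zero.mp this

/-! ### Traces -/

/-- All the powers `ζ^k`, `1 ≤ k ≤ 2d`, have the same trace (they are Galois conjugate). -/
theorem trace_ζ_pow (k : ℕ) (hk0 : k ≠ 0) (hk : k < d + d + 1) :
    Algebra.trace ℚ (K d) (ζ d ^ k) = Algebra.trace ℚ (K d) (ζ d) := by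
  have hcop : k.Coprime (d + d + 1) := (Nat.coprime_of_lt_prime hk0 hk hr.out).symm
  have hμ : IsPrimitiveRoot (ζ d ^ k) (d + d + 1) := (isPrimitiveRoot_ζ d).pow_of_coprime k hcop
  have hirr : Irreducible (cyclotomic (d + d + 1) ℚ) := cyclotomic.irreducible_rat (by omega)
  have hσ := IsCyclotomicExtension.fromZetaAut_spec hμ hirr
  -- `σ ζ = ζ^k` for `σ = fromZetaAut`
  conv_lhs => rw [← hσ]
  exact Algebra.trace_eq_of_algEquiv (IsCyclotomicExtension.fromZetaAut hμ hirr) _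

/-- The trace of `x c` is `Tr(ζ) · ∑_i c(fold i)`. -/
theorem trace_x (c : Fin d → ℤ) :
    Algebra.trace ℚ (K d) (algebraMap (𝓞 (K d)) (K d) (x d c)) =
      (∑ i : Fin (d + d), (c (fold d i) : ℚ)) * Algebra.trace ℚ (K d) (ζ d) := by
  rw [coe_x, map_sum, Finset.sum_mul]
  refine Finset.sum_congr rfl fun i _ => ?_
  rw [map_smul, smul_eq_mul, trace_ζ_pow d _ (by omega) (by omega)]

/-- **Trace zero.**  The elements `x (ext b)` have trace `0`. -/
theorem trace_x_ext (hd : 0 < d) (b : Fin d → ℤ) :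
    Algebra.trace ℚ (K d) (algebraMap (𝓞 (K d)) (K d) (x d (ext d b))) = 0 := by
  rw [trace_x, sum_fold d (fun j => ((ext d b j : ℤ) : ℚ))]
  have : ∑ j : Fin d, ((ext d b j : ℤ) : ℚ) = 0 := by
    rw [← Int.cast_sum, sum_ext d hd]; simp
  rw [this]; simp

/-! ### The two reductions modulo a split prime -/

variable {p : ℕ} [Fact p.Prime]

/-- A primitive `(2d+1)`-st root of unity `g` of `ZMod p` is a root of the minimal polynomial
(the cyclotomic polynomial) of `ζ`. -/
theorem aeval_minpoly_gen (g : ZMod p) (hg : IsPrimitiveRoot g (d + d + 1)) :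
    aeval g (minpoly ℤ (isPrimitiveRoot_ζ d).integralPowerBasis.gen) = 0 := by
  have h2 : 2 ≤ d + d + 1 := hr.out.two_le
  have hp : ((d + d + 1 : ℕ) : ZMod p) ≠ 0 := by
    intro h0
    have hdvd : p ∣ d + d + 1 := (ZMod.natCast_eq_zero_iff _ _).mp h0
    have hpr : p = d + d + 1 := (Nat.prime_dvd_prime_iff_eq (Fact.out) hr.out).mp hdvd
    have hgp : g ^ (d + d + 1) = g := by rw [← hpr]; exact ZMod.pow_card g
    rw [hg.pow_eq_one] at hgp
    exact hg.ne_one (by omega) hgp.symm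
  haveI : NeZero ((d + d + 1 : ℕ) : ZMod p) := ⟨hp⟩
  have hmin : minpoly ℤ (isPrimitiveRoot_ζ d).toInteger = cyclotomic (d + d + 1) ℤ := by
    rw [← NumberField.RingOfIntegers.minpoly_coe]
    exact (cyclotomic_eq_minpoly (isPrimitiveRoot_ζ d) (by omega)).symm
  rw [IsPrimitiveRoot.integralPowerBasis_gen, hmin, aeval_def, eval₂_eq_eval_map, map_cyclotomic,
    ← IsRoot.def, isRoot_cyclotomic_iff]
  exact hg

/-- The ring map `ℤ[ζ] = 𝓞 K → ZMod p` sending `ζ` to a primitive `(2d+1)`-st root of unity `g`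
of `ZMod p` (such `g` exist exactly when `p ≡ 1 (mod 2d+1)`). -/
def red (g : ZMod p) (hg : IsPrimitiveRoot g (d + d + 1)) : 𝓞 (K d) →+* ZMod p :=
  ((isPrimitiveRoot_ζ d).integralPowerBasis.lift g (aeval_minpoly_gen d g hg)).toRingHom

/-- `red g` sends `ζ` to `g`. -/
theorem red_ζi (g : ZMod p) (hg : IsPrimitiveRoot g (d + d + 1)) : red d g hg (ζi d) = g := by
  have h := (isPrimitiveRoot_ζ d).integralPowerBasis.lift_gen g (aeval_minpoly_gen d g hg)
  rw [IsPrimitiveRoot.integralPowerBasis_gen] at h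
  exact h

/-- The reduction of `x c` is the folded sum in `g`. -/
theorem red_x (g : ZMod p) (hg : IsPrimitiveRoot g (d + d + 1)) (c : Fin d → ℤ) :
    red d g hg (x d c) = ∑ i : Fin (d + d), (c (fold d i) : ZMod p) * g ^ ((i : ℕ) + 1) := by
  simp only [x, map_sum, map_mul, map_pow, map_intCast, red_ζi]

omit hr in
/-- The inverse of a primitive root of unity is one. -/
theorem isPrimitiveRoot_inv {g : ZMod p} (hg : IsPrimitiveRoot g (d + d + 1)) :
    IsPrimitiveRoot g⁻¹ (d + d + 1) := hg.inv

/-- **The two reductions agree on real elements.**  Sending `ζ ↦ g⁻¹` instead of `ζ ↦ g`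
(i.e. composing with complex conjugation) does not change the image of `x c`. -/
theorem red_inv_x (g : ZMod p) (hg : IsPrimitiveRoot g (d + d + 1)) (c : Fin d → ℤ) :
    red d g⁻¹ (isPrimitiveRoot_inv d hg) (x d c) = red d g hg (x d c) := by
  rw [red_x, red_x]
  exact sum_fold_inv d g hg.pow_eq_one (fun j => (c j : ZMod p))

/-- **The two reductions have different kernels** (the prime `p ≡ 1 (mod 2d+1)` splits, and
complex conjugation moves the chosen prime above it): `ζ - g` dies under `ζ ↦ g` but not under
`ζ ↦ g⁻¹`, because `g² ≠ 1`. -/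
theorem ker_red_ne (g : ZMod p) (hg : IsPrimitiveRoot g (d + d + 1)) :
    RingHom.ker (red d g hg) ≠ RingHom.ker (red d g⁻¹ (isPrimitiveRoot_inv d hg)) := by
  have h2 : 2 ≤ d + d + 1 := hr.out.two_le
  intro hker
  have hz : ζi d - ((g.val : ℕ) : 𝓞 (K d)) ∈ RingHom.ker (red d g hg) := by
    rw [RingHom.mem_ker, map_sub, red_ζi, map_natCast, ZMod.natCast_zmod_val, sub_self]
  rw [hker, RingHom.mem_ker, map_sub, red_ζi, map_natCast, ZMod.natCast_zmod_val,
    sub_eq_zero] at hz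
  -- `hz : g⁻¹ = g`, i.e. `g ^ 2 = 1`
  have hg0 : g ≠ 0 := hg.ne_zero (by omega)
  have hsq : g ^ 2 = 1 := by
    rw [sq]
    nth_rewrite 1 [← hz]
    exact inv_mul_cancel₀ hg0
  exact hg.pow_ne_one_of_pos_of_lt (by norm_num) (by omega) hsq

end Summit.MatrixMultiplication.MatrixMultiplication.Theorems.LevelOneGL2Designs.CyclotomicLift
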